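import Summits.QuantumFields.BalabanUV.T4Continuum.Support.AbelianCovariantLaplacian
import Summits.QuantumFields.BalabanUV.T4Continuum.Support.PerturbedLimitAnalytic
import Summits.QuantumFields.BalabanUV.T4Continuum.Support.PerturbedCovLiaison
import Summits.QuantumFields.BalabanUV.T4Continuum.Support.BalabanAveragingPairing
import Summits.QuantumFields.BalabanUV.T4Continuum.Support.CovariantAveragingModel

/-!
# T⁴ programme, spine node NE2 (U1a) — THE BACKGROUND LAYER BY NAME: the abelian covariant-Laplacian coupling through every
# station of the resolvent route (rate, named limit, Lipschitz, holomorphy, liaison `LocalRate`, Bałaban's and transported averaging)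

Ninth generation of the NE2 prover lineage P1 of the cell `pub-balaban`, file 15 — the ENTRY POINT of the gen-9 background layer.
Generation 8 closed the `U = 1` layer of node U1a by name (`Spine/NE2UnitLayer.lean`); this file does the same for the first
background-dependent layer that is an honest operator (not an ad hoc model): Bałaban's free operator `Δ_a` with its nearest-
neighbour vector Laplacian replaced by the ABELIAN COVARIANT one, `Δ_a + t·(Δ^{U} − Δ^{1})` (`AbelianCovariantLaplacian.covPert`),
for a tower of transporters `u^{(k)}` whose connection `−w^{(k)} = −L^k(u^{(k)} − 1)` is a `LipschitzBackground (α, β)` and whose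
zeroth-order field `z^{(k)}` is a `BoundedBackground (α′, β′)`; `κ_cov = 2d(α + β)Cst + α′Cst`, `C₂^cov = C₂ + C₂ᴴ + Cst²β′`:

 * §1 **`pertLim_sub_pertLim_zero_le`** (generic): `‖c_∞(t) − c_∞(0)‖ ≤ ‖t‖κ·Cst·(1 − ‖t‖κ)^{−1}` for the NAMED limit `pertLim`;
 * §2 the covariant-Laplacian layer: **`cov_rate`** (King-averaged η-rate `L^{−k}`, all `‖t‖κ_cov < 1`), **`cov_tendsto`** (named
   limit + rate), **`cov_lipschitz`**, **`cov_holomorphic`** (`DifferentiableOn ℂ` on the Neumann disc), **`cov_mem_readings`** /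
   **`cov_localRate`** (the liaison shape `T4EtaRateMin.LocalRate` instantiated), **`cov_rate_balaban`** (Bałaban's `Q̄ = QB`
   averaging, pairing defect `f_k = dLCst·L^{−k}`), **`cov_rate_transported`** (background-transported averaging `Q·diag(u′)`,
   `UnimodularTransport γ`), and **`cov_rate_at_one`** (the physical value `t = 1` in the small-field regime `κ_cov < 1`);
 * §3 **`ne2_background_layer`**: the conjunction, by name.

HONEST FRAMING (T4-DAG p. 1).  Everything here is proved from the tree's `U = 1` theorems ((1.69), (1.83), (1.89), King's Lemma
4.5 mechanism) and exact lattice identities; model-level: ABELIAN transporters, GLOBAL small field, the `−∂P∂*`/`aQ*Q` parts of `Δ_a`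
NOT covariantized, `Δ^1 = Σ∇ᴴ∇` not identified entry-wise with the Laplacian summand of the spectrally defined `calDa`, finite
torus, linear layer, operator norm; rates / pairings / constants OURS; NOT Bałaban's (3.23)–(3.24) for his `Δ_a(U)`; NOT infinite
volume / mass gap / Clay / summit progress; spine 0/9 unchanged.  HONEST DEPENDENCY: continuum YM on T⁴ ⇐ BetaPertH ∧ nine spine
estimates (0/9 proved); BetaPertH ⇐ (D1) ∧ (D4) ∧ CAP+tail; G-an2-4 gates asym, D1 and NE2/3/4 (the U = 1 wall; NOT used here).
ABSOLUTE RULE kept; no `sorry`.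
-/

noncomputable section

open scoped BigOperators ComplexConjugate Matrix Matrix.Norms.L2Operator
open Filter Topology

namespace Summit.QuantumFields.BalabanUV.T4Continuum.NE2BackgroundLayer

open Literature.MathematicalPhysics.QuantumFieldTheory.Balaban1983to89.B5Prop11Plancherel (Cst Cst_nonneg)
open Literature.MathematicalPhysics.QuantumFieldTheory.Balaban1983to89.T4EtaRateMin (Readings LocalRate)
open Summit.QuantumFields.BalabanUV.T4Continuum
open Summit.QuantumFields.BalabanUV.T4Continuum.CovariantAveragingTower (TowerLimitRate)
open Summit.QuantumFields.BalabanUV.T4Continuum.BalabanAveragedTowerUnit (idx Qlev QBlev)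
open Summit.QuantumFields.BalabanUV.T4Continuum.BackgroundResolventTower
open Summit.QuantumFields.BalabanUV.T4Continuum.KingPairingPlantedLaw
open Summit.QuantumFields.BalabanUV.T4Continuum.NE2PerturbedLayer
open Summit.QuantumFields.BalabanUV.T4Continuum.FirstOrderBackgroundModel
open Summit.QuantumFields.BalabanUV.T4Continuum.PerturbationAlgebra
open Summit.QuantumFields.BalabanUV.T4Continuum.FirstOrderAdjointModel
open Summit.QuantumFields.BalabanUV.T4Continuum.AbelianCovariantLaplacian
open Summit.QuantumFields.BalabanUV.T4Continuum.PerturbedLimitAnalytic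
open Summit.QuantumFields.BalabanUV.T4Continuum.PerturbedCovLiaison
open Summit.QuantumFields.BalabanUV.T4Continuum.BalabanAveragingPairing
open Summit.QuantumFields.BalabanUV.T4Continuum.CovariantAveragingModel

variable {d : ℕ} (L : ℕ) [NeZero L] (M : Fin d → ℕ) [hM : ∀ μ, NeZero (M μ)] (a : ℝ) (ha : 0 < a)

/-! ## §1 Lipschitz dependence of the NAMED limit on the coupling -/

/-- **`‖c_∞(t) − c_∞(0)‖ ≤ ‖t‖κ·Cst·(1 − ‖t‖κ)^{−1}`** for the named limit `pertLim` of any admissible family (`L ≥ 2`).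
[cite: Balaban1984PropagatorsI, Prop. 1.1 (1.89) p.33; King1986, Lemma 4.5 p.674] [folklore] -/
theorem pertLim_sub_pertLim_zero_le (hL : 2 ≤ L) {P : (k : ℕ) → Matrix (idx L M k) (idx L M k) ℂ} {κ C₂ : ℝ}
    (hpert : PerturbationLaws (calDalev L M a ha) P (JpcT L M) κ (fun k => C₂ * ((L : ℝ)⁻¹) ^ k)) {t : ℂ} (ht : ‖t‖ * κ < 1) :
    ‖pertLim L M a ha P t - pertLim L M a ha P 0‖ ≤ ‖t‖ * κ * Cst d a * (1 - ‖t‖ * κ)⁻¹ := by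
  have h0 : ‖(0 : ℂ)‖ * κ < 1 := by rw [norm_zero, zero_mul]; exact zero_lt_one
  exact pertLimit_sub_le L M a ha hpert ht (tendsto_pertLim L M a ha hL hpert ht).1 (tendsto_pertLim L M a ha hL hpert h0).1

/-! ## §2 The covariant-Laplacian layer, station by station -/

section Cov

variable {u : (k : ℕ) → Fin d → (idx L M k → ℂ)} {α β α' β' : ℝ}

/-- the Neumann constant of the covariant-Laplacian coupling `κ_cov = 2d(α + β)Cst + α′Cst`. [folklore] -/
def kappaCov (d : ℕ) (a α β α' : ℝ) : ℝ := 2 * (d * (α + β) * Cst d a) + α' * Cst d a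

/-- its consistency constant `C₂^cov = C₂ + C₂ᴴ + Cst²β′`. [folklore] -/
def C2cov (d L : ℕ) (a α β β' : ℝ) : ℝ := C2model d L a α β + C2adj d L a α β + Cst d a * β' * Cst d a

/-- the typed inequalities for the covariant-Laplacian family, with the named constants. [folklore] -/
theorem cov_laws (hd : 1 ≤ d) (hV : LipschitzBackground L M (connV L M u) α β) (hz : BoundedBackground L M (zT L M u) α' β') :
    PerturbationLaws (calDalev L M a ha) (covPert L M u) (JpcT L M) (kappaCov d a α β α')
      (fun k => C2cov d L a α β β' * ((L : ℝ)⁻¹) ^ k) :=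
  perturbationLaws_covariantLaplacian L M a ha hd hV hz

/-- (1) **RATE**: King-averaged unit-lattice covariances of `(Δ_a^{(k)} + t(Δ^{U_k} − Δ^1))⁻¹` converge with rate `L^{−k}`. [folklore] -/
theorem cov_rate (hL : 2 ≤ L) (hd : 1 ≤ d) (hV : LipschitzBackground L M (connV L M u) α β)
    (hz : BoundedBackground L M (zT L M u) α' β') {t : ℂ} (ht : ‖t‖ * kappaCov d a α β α' < 1) :
    TowerLimitRate (Qlev L M) ((L : ℝ) ^ d) (fun k => (calDalev L M a ha k + t • covPert L M u k)⁻¹)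
      (Cpert (kappaCov d a α β α') (2 * d * Cst d a) (CJ d a) (C2cov d L a α β β') 0 t) ((L : ℝ)⁻¹) :=
  towerLimitRate_perturbed_king L M a ha hL (cov_laws L M a ha hd hV hz) ht

/-- (2) **NAMED LIMIT** `c_∞(t) = pertLim … (covPert u) t` with the rate bound. [folklore] -/
theorem cov_tendsto (hL : 2 ≤ L) (hd : 1 ≤ d) (hV : LipschitzBackground L M (connV L M u) α β)
    (hz : BoundedBackground L M (zT L M u) α' β') {t : ℂ} (ht : ‖t‖ * kappaCov d a α β α' < 1) :
    Tendsto (pertCov L M a ha (covPert L M u) t) atTop (𝓝 (pertLim L M a ha (covPert L M u) t)) ∧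
      ∀ k, ‖pertCov L M a ha (covPert L M u) t k - pertLim L M a ha (covPert L M u) t‖
        ≤ Cpert (kappaCov d a α β α') (2 * d * Cst d a) (CJ d a) (C2cov d L a α β β') 0 t * ((L : ℝ)⁻¹) ^ k
            / (1 - (L : ℝ)⁻¹) :=
  tendsto_pertLim L M a ha hL (cov_laws L M a ha hd hV hz) ht

/-- (3) **LIPSCHITZ IN THE COUPLING**: `‖c_∞(t) − c_∞(0)‖ ≤ ‖t‖κ_cov·Cst·(1 − ‖t‖κ_cov)^{−1}`. [folklore] -/
theorem cov_lipschitz (hL : 2 ≤ L) (hd : 1 ≤ d) (hV : LipschitzBackground L M (connV L M u) α β)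
    (hz : BoundedBackground L M (zT L M u) α' β') {t : ℂ} (ht : ‖t‖ * kappaCov d a α β α' < 1) :
    ‖pertLim L M a ha (covPert L M u) t - pertLim L M a ha (covPert L M u) 0‖
      ≤ ‖t‖ * kappaCov d a α β α' * Cst d a * (1 - ‖t‖ * kappaCov d a α β α')⁻¹ :=
  pertLim_sub_pertLim_zero_le L M a ha hL (cov_laws L M a ha hd hV hz) ht

/-- (4) **HOLOMORPHY IN THE COUPLING**: `t ↦ c_∞(t)` is complex-differentiable on the Neumann disc `‖t‖κ_cov < 1`. [folklore] -/
theorem cov_holomorphic (hL : 2 ≤ L) (hd : 1 ≤ d) (hV : LipschitzBackground L M (connV L M u) α β)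
    (hz : BoundedBackground L M (zT L M u) α' β') :
    DifferentiableOn ℂ (pertLim L M a ha (covPert L M u)) {t : ℂ | ‖t‖ * kappaCov d a α β α' < 1} :=
  differentiableOn_pertLim L M a ha hL (cov_laws L M a ha hd hV hz)

/-- (5a) the covariant-Laplacian family is a datum of the liaison readings `pertReadings κ_cov C₂^cov t`. [folklore] -/
theorem cov_mem_readings (hd : 1 ≤ d) (hV : LipschitzBackground L M (connV L M u) α β)
    (hz : BoundedBackground L M (zT L M u) α' β') (t : ℂ) :
    covPert L M u ∈ (pertReadings L M a ha (kappaCov d a α β α') (C2cov d L a α β β') t).dom :=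
  cov_laws L M a ha hd hV hz

/-- (5b) **THE LIAISON SHAPE `LocalRate`** for those readings (uniform over the class, so in particular for `covPert u`). [folklore] -/
theorem cov_localRate {t : ℂ} (ht : ‖t‖ * kappaCov d a α β α' < 1) :
    LocalRate (pertReadings L M a ha (kappaCov d a α β α') (C2cov d L a α β β') t)
      (Cpert (kappaCov d a α β α') (2 * d * Cst d a) (CJ d a) (C2cov d L a α β β') 0 t) ((L : ℝ)⁻¹) :=
  localRate_pertCov L M a ha _ _ ht

/-- (6) **BAŁABAN'S AVERAGING `Q̄ = QB`** of the same propagators: rate `L^{−k}` with the pairing defect `f_k = dLCst·L^{−k}`. [folklore] -/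
theorem cov_rate_balaban (hL : 2 ≤ L) (hd : 1 ≤ d) (hV : LipschitzBackground L M (connV L M u) α β)
    (hz : BoundedBackground L M (zT L M u) α' β') {t : ℂ} (ht : ‖t‖ * kappaCov d a α β α' < 1) :
    TowerLimitRate (QBlev L M) ((L : ℝ) ^ d) (fun k => (calDalev L M a ha k + t • covPert L M u k)⁻¹)
      (Cpert (kappaCov d a α β α') (2 * d * Cst d a) (CJ d a) (C2cov d L a α β β') (d * L * Cst d a) t) ((L : ℝ)⁻¹) :=
  towerLimitRate_perturbed_balaban L M a ha hL (cov_laws L M a ha hd hV hz) ht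

/-- (7) **BACKGROUND-TRANSPORTED AVERAGING `Q·diag(u′)`** (`UnimodularTransport u′ γ`) of the same propagators. [folklore] -/
theorem cov_rate_transported (hL : 2 ≤ L) (hd : 1 ≤ d) (hV : LipschitzBackground L M (connV L M u) α β)
    (hz : BoundedBackground L M (zT L M u) α' β') {u' : (k : ℕ) → (idx L M (k + 1) → ℂ)} {γ : ℝ}
    (hu' : UnimodularTransport L M u' γ) {t : ℂ} (ht : ‖t‖ * kappaCov d a α β α' < 1) :
    TowerLimitRate (Acov L M u') ((L : ℝ) ^ d) (fun k => (calDalev L M a ha k + t • covPert L M u k)⁻¹)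
      (Cpert (kappaCov d a α β α') (2 * d * Cst d a) (CJ d a) (C2cov d L a α β β') (γ * Cst d a) t) ((L : ℝ)⁻¹) :=
  towerLimitRate_perturbed_covariant L M a ha hL hu' (cov_laws L M a ha hd hV hz) ht

/-- (8) **THE PHYSICAL VALUE `t = 1`** in the small-field regime `κ_cov < 1`. [folklore] -/
theorem cov_rate_at_one (hL : 2 ≤ L) (hd : 1 ≤ d) (hV : LipschitzBackground L M (connV L M u) α β)
    (hz : BoundedBackground L M (zT L M u) α' β') (hsmall : kappaCov d a α β α' < 1) :
    TowerLimitRate (Qlev L M) ((L : ℝ) ^ d) (fun k => (calDalev L M a ha k + covPert L M u k)⁻¹)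
      (Cpert (kappaCov d a α β α') (2 * d * Cst d a) (CJ d a) (C2cov d L a α β β') 0 1) ((L : ℝ)⁻¹) :=
  covariantLaplacian_rate L M a ha hL hd hV hz hsmall

end Cov

/-! ## §3 The layer by name -/

/-- **THE NE2 BACKGROUND LAYER (abelian covariant-Laplacian coupling) BY NAME** (`L ≥ 2`, `d ≥ 1`): for every tower of transporters
with `LipschitzBackground` connection and `BoundedBackground` zeroth-order field and every coupling in the Neumann disc: (1) the
King-averaged unit-lattice covariances of `(Δ_a + t(Δ^U − Δ^1))⁻¹` converge with rate `L^{−k}` to the named limit `c_∞(t)`; (2) `c_∞`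
is Lipschitz at `t = 0` with constant `κ_cov·Cst·(1 − ‖t‖κ_cov)^{−1}`; (3) `c_∞` is holomorphic on the disc; (4) Bałaban's averaging and
any unimodular transported averaging give the same rate with explicit constants.  Model-level; NOT [B9] (3.23)–(3.24); spine 0/9
unchanged. [cite: King1986, Lemma 4.5 (4.32)/(4.38) p.674; Balaban1984PropagatorsI, (1.69) p.29, (1.83) p.31, Prop. 1.1 (1.89) p.33;
Balaban1985BackgroundPropagators, (3.3) p.390, Thm 3.4 p.400 (shapes only)] [folklore] -/
theorem ne2_background_layer (hL : 2 ≤ L) (hd : 1 ≤ d) {u : (k : ℕ) → Fin d → (idx L M k → ℂ)} {α β α' β' : ℝ}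
    (hV : LipschitzBackground L M (connV L M u) α β) (hz : BoundedBackground L M (zT L M u) α' β')
    {u' : (k : ℕ) → (idx L M (k + 1) → ℂ)} {γ : ℝ} (hu' : UnimodularTransport L M u' γ) {t : ℂ}
    (ht : ‖t‖ * kappaCov d a α β α' < 1) :
    (Tendsto (pertCov L M a ha (covPert L M u) t) atTop (𝓝 (pertLim L M a ha (covPert L M u) t)) ∧
      ∀ k, ‖pertCov L M a ha (covPert L M u) t k - pertLim L M a ha (covPert L M u) t‖
        ≤ Cpert (kappaCov d a α β α') (2 * d * Cst d a) (CJ d a) (C2cov d L a α β β') 0 t * ((L : ℝ)⁻¹) ^ k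
            / (1 - (L : ℝ)⁻¹)) ∧
    ‖pertLim L M a ha (covPert L M u) t - pertLim L M a ha (covPert L M u) 0‖
        ≤ ‖t‖ * kappaCov d a α β α' * Cst d a * (1 - ‖t‖ * kappaCov d a α β α')⁻¹ ∧
    DifferentiableOn ℂ (pertLim L M a ha (covPert L M u)) {t : ℂ | ‖t‖ * kappaCov d a α β α' < 1} ∧
    TowerLimitRate (QBlev L M) ((L : ℝ) ^ d) (fun k => (calDalev L M a ha k + t • covPert L M u k)⁻¹)
      (Cpert (kappaCov d a α β α') (2 * d * Cst d a) (CJ d a) (C2cov d L a α β β') (d * L * Cst d a) t) ((L : ℝ)⁻¹) ∧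
    TowerLimitRate (Acov L M u') ((L : ℝ) ^ d) (fun k => (calDalev L M a ha k + t • covPert L M u k)⁻¹)
      (Cpert (kappaCov d a α β α') (2 * d * Cst d a) (CJ d a) (C2cov d L a α β β') (γ * Cst d a) t) ((L : ℝ)⁻¹) :=
  ⟨cov_tendsto L M a ha hL hd hV hz ht, cov_lipschitz L M a ha hL hd hV hz ht, cov_holomorphic L M a ha hL hd hV hz,
    cov_rate_balaban L M a ha hL hd hV hz ht, cov_rate_transported L M a ha hL hd hV hz hu' ht⟩

end Summit.QuantumFields.BalabanUV.T4Continuum.NE2BackgroundLayer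

end
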